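import Mathlib
import Summits.Ventures.HodgeRepro2.A1TensorSplitting
import Summits.Ventures.HodgeRepro2.A1IdempotentDecomposition

/-!
# A1EigenlineDecomposition — (A0.4): a module over `ℂ ⊗[ℚ] F` is the direct sum of its `σ`-eigenlines

route/T4-A1-p7.md (A0.4): for the CM field `F` and a CM abelian variety `A` with `F ⊆ End⁰(A)`, the
complexified cohomology `H¹(A, ℂ)` — a module over `F ⊗_ℚ ℂ ≅ ∏_σ ℂ` — is the direct sum of the
eigenlines `ℓ_σ = {v | x·v = σ(x) v for all x ∈ F}`, `σ` running over the complex embeddings of `F`.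
This file proves the module-theoretic statement behind it, for ANY module `M` over `ℂ ⊗[ℚ] F`
(`F` any finite-dimensional field extension of `ℚ`): with

* `A1TensorSplitting.tensorEquiv F : ℂ ⊗[ℚ] F ≃ₐ[ℂ] ((F →ₐ[ℚ] ℂ) → ℂ)` (p392690), and
* `A1IdempotentDecomposition.isInternal_eigenspace` — a module over the product ring `∏_σ ℂ` is the
  internal direct sum of its coordinate eigenspaces (p392745),

`M` becomes a module over `∏_σ ℂ` (`piModule`, scalars transported along `tensorEquiv`), the
`σ`-eigenline `eigenline F M σ := {m | ∀ x : F, (1 ⊗ x) • m = (σ x ⊗ 1) • m}` is exactly the `σ`-th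
coordinate eigenspace (`eigenline_eq_piece`), and therefore (`isInternal_eigenline`)
`M = ⊕_σ eigenline F M σ`.  Nothing about cohomology or abelian varieties is asserted: `H¹(A, ℂ)`
enters only as an abstract module over `ℂ ⊗[ℚ] F`.
-/

namespace Summit.Ventures.HodgeRepro2.A1EigenlineDecomposition

open TensorProduct
open Summit.Ventures.HodgeRepro2.A1TensorSplitting
open Summit.Ventures.HodgeRepro2.A1IdempotentDecomposition

variable (F : Type*) [Field F] [Algebra ℚ F] [FiniteDimensional ℚ F]

/-- The embeddings of `F` into `ℂ` (the index set of the eigenlines). -/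
abbrev Emb := F →ₐ[ℚ] ℂ

/-- The ring homomorphism `∏_σ ℂ → ℂ ⊗[ℚ] F` inverse to `tensorEquiv F`. -/
noncomputable def fromPi : (Emb F → ℂ) →+* ℂ ⊗[ℚ] F :=
  ((tensorEquiv F).symm : (Emb F → ℂ) ≃ₐ[ℂ] ℂ ⊗[ℚ] F).toRingEquiv.toRingHom

/-- `fromPi` inverts `tensorEquiv`. -/
theorem fromPi_tensorEquiv (t : ℂ ⊗[ℚ] F) : fromPi F (tensorEquiv F t) = t := by
  simp [fromPi]

/-- `tensorEquiv` inverts `fromPi`. -/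
theorem tensorEquiv_fromPi (a : Emb F → ℂ) : tensorEquiv F (fromPi F a) = a := by
  simp [fromPi]

/-- The constant function `σ ↦ c` corresponds to `c ⊗ 1`. -/
theorem fromPi_const (c : ℂ) : fromPi F (fun _ => c) = c ⊗ₜ[ℚ] (1 : F) := by
  rw [← fromPi_tensorEquiv F (c ⊗ₜ[ℚ] (1 : F))]
  congr 1
  funext σ
  rw [tensorEquiv_tmul, map_one, mul_one]

/-- The tuple of embeddings `σ ↦ σ x` corresponds to `1 ⊗ x`. -/
theorem fromPi_embeddings (x : F) : fromPi F (fun σ : Emb F => σ x) = (1 : ℂ) ⊗ₜ[ℚ] x := by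
  rw [← fromPi_tensorEquiv F ((1 : ℂ) ⊗ₜ[ℚ] x)]
  congr 1
  funext σ
  rw [tensorEquiv_tmul, one_mul]

variable {M : Type*} [AddCommGroup M] [Module (ℂ ⊗[ℚ] F) M]

/-- `M` as a module over the product ring `∏_σ ℂ`, the scalars transported along `tensorEquiv`. -/
noncomputable scoped instance piModule : Module (Emb F → ℂ) M :=
  Module.compHom M (fromPi F)

/-- The transported action, by definition. -/
theorem pi_smul_def (a : Emb F → ℂ) (m : M) : a • m = fromPi F a • m := rfl

/-- The `σ`-eigenline of `M`: the vectors on which `1 ⊗ x` acts as the scalar `σ x` (i.e. as `σ x ⊗ 1`),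
for every `x ∈ F`. -/
def eigenline (σ : Emb F) : Submodule (Emb F → ℂ) M where
  carrier := {m | ∀ x : F, ((1 : ℂ) ⊗ₜ[ℚ] x) • m = (σ x ⊗ₜ[ℚ] (1 : F)) • m}
  zero_mem' := fun x => by simp
  add_mem' := fun {m₁ m₂} h₁ h₂ x => by rw [smul_add, smul_add, h₁ x, h₂ x]
  smul_mem' := fun a m hm x => by
    show ((1 : ℂ) ⊗ₜ[ℚ] x) • (fromPi F a • m) = (σ x ⊗ₜ[ℚ] (1 : F)) • (fromPi F a • m)
    rw [smul_smul, mul_comm, mul_smul, hm x, smul_smul, mul_comm, mul_smul]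

/-- Membership in the `σ`-eigenline. -/
theorem mem_eigenline (σ : Emb F) (m : M) :
    m ∈ eigenline F σ ↔ ∀ x : F, ((1 : ℂ) ⊗ₜ[ℚ] x) • m = (σ x ⊗ₜ[ℚ] (1 : F)) • m :=
  Iff.rfl

/-- On a vector of the `σ`-eigenline every `t ∈ ℂ ⊗[ℚ] F` acts as the scalar `(tensorEquiv t) σ`. -/
theorem smul_of_mem_eigenline {σ : Emb F} {m : M} (hm : m ∈ eigenline F σ) (t : ℂ ⊗[ℚ] F) :
    t • m = (tensorEquiv F t σ ⊗ₜ[ℚ] (1 : F)) • m := by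
  induction t using TensorProduct.induction_on with
  | zero => simp
  | tmul c x =>
    have h1 : c ⊗ₜ[ℚ] x = (c ⊗ₜ[ℚ] (1 : F)) * ((1 : ℂ) ⊗ₜ[ℚ] x) := by
      rw [Algebra.TensorProduct.tmul_mul_tmul, mul_one, one_mul]
    rw [tensorEquiv_tmul, h1, mul_smul, (mem_eigenline F σ m).1 hm x, smul_smul,
      Algebra.TensorProduct.tmul_mul_tmul, mul_one]
  | add t₁ t₂ h₁ h₂ =>
    rw [add_smul, h₁, h₂, map_add, Pi.add_apply, add_tmul, add_smul]

variable [DecidableEq (Emb F)]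

/-- The `σ`-eigenline is the `σ`-th coordinate eigenspace of the `∏_σ ℂ`-module `M`. -/
theorem eigenline_eq_piece (σ : Emb F) :
    eigenline F σ = piece (M := M) (coordIdem ℂ (Emb F)) σ := by
  ext m
  rw [mem_piece_iff_forall_smul_eq, mem_eigenline]
  constructor
  · intro hm a
    rw [pi_smul_def, pi_smul_def, fromPi_const, smul_of_mem_eigenline F hm (fromPi F a),
      tensorEquiv_fromPi]
  · intro h x
    have := h (fun τ : Emb F => τ x)
    rw [pi_smul_def, pi_smul_def, fromPi_embeddings, fromPi_const] at this
    exact this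

/-- **(A0.4)**: a module over `ℂ ⊗[ℚ] F` is the internal direct sum of its `σ`-eigenlines,
`σ` running over the complex embeddings of `F`. -/
theorem isInternal_eigenline : DirectSum.IsInternal (eigenline F (M := M)) := by
  have h : eigenline F (M := M) = piece (M := M) (coordIdem ℂ (Emb F)) :=
    funext (eigenline_eq_piece F)
  rw [h]
  exact isInternal_eigenspace

end Summit.Ventures.HodgeRepro2.A1EigenlineDecomposition
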